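import Summits.Ventures.CertifiedManyBodySolver.Downfold.EmeryBoxesHg1201LRFBThermalCapRetiltMarkovBoxp1
import Summits.Ventures.CertifiedManyBodySolver.Downfold.EmeryBoxesHg1201LRFBThermalFloorAtlasWord
import Summits.Ventures.CertifiedManyBodySolver.Downfold.EmeryThermalAtomicFloor
import HarnessLib

/-!
# HIGH-TEMPERATURE-CLOSING `T > 0` WINDOW on HgBa2CuO4 (M19) U-SLICE «cGW-SIC+LRFB» (8.986, 5.404) — `emeryBoxHg1201LRFB` (router/EMERY-FLOOR-ORDERS row 10): the ATOMIC-LIMIT floor (full entropy) ∨ the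
# family floor, against the re-tilted cap — both sides meet at `6 log 2` as β → 0

Venture CertifiedManyBodySolver, cell `pub/hubbard-downfold` (S1 = ROUTER) × crew hubbard-fast S2 (ii) × (iv) «T > 0 × multi-band» (D-0096 (ii)); seat hubbard-downfold-mod-4
(S1/S2 Emery seam, g17). Namespace `Summit.Ventures.CertifiedManyBodySolver.Downfold`. DOOR: `EmeryThermalAtomicFloor` (`holdsOn_emeryCellPressureAtomicFloor`: Peierls on the
whole occupation basis of the `Cu₄O₈` block, site-wise factorisation; the one-site function is the tree's `atomicPartitionFnReal β U μ`). INPUTS BY NAME: the family floor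
`emeryBoxHg1201LRFB_pressureFloorFam_m99o10` (`EmeryBoxesHg1201LRFBThermalFloorAtlasWord`; C = (-156.157017, -156.047322)), the cap `emeryBoxHg1201LRFB_pressureCap_m99o10_retilt` (`EmeryBoxesHg1201LRFBThermalCapRetiltMarkovBoxp1`; `6 log 2 + 44.4973·β`; flat word 48.8973).
ATOMIC DATA: Cu at `μ_d = −(εp + Δ_hi) = 929/100`, `U_d,hi = 4493/500`; O at `μ_p = −εp = 99/10`, `U_p,hi = 1351/250` ⇒ classical slope 38.3860·β (family slope 39.0393; cap 44.4973).
RESULT: **`emeryBoxHg1201LRFB_pressureWindowHighT_m99o10`**: `max(atomic, family) ≤ P_cell ≤ 6 log 2 + 44.4973·β` on the whole box, every β ≥ 0; width → 0 as β → 0 (both sides `6 log 2`,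
`emeryBoxHg1201LRFB_pressure_beta_zero_m99o10`); crossover β* ≈ 1.142 (T* ≈ 10158 K) below which the atomic floor is the better floor [float].

Everything PROVED (0 sorry); no definition. HONEST FRAMING: CERTIFIED inequalities on a SCREENING/EXTRAPOLATED-grade object; the atomic floor ignores hopping (its slope sits
0.6533 below the family floor's), so at physical temperatures (β ≈ 20–40 eV⁻¹) the family floor still decides and thermal scales are NOT resolved there; what is new
is the correct INFINITE-TEMPERATURE closure of the window and a certified high-T regime (β ≲ β*) with width `≈ 6.1113·β`; grand-canonical at the stated level; no phase word;
no router number moves. WHAT-THIS-IS-NOT: a new certificate (pure algebra on landed objects; zero kit).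
-/

noncomputable section

namespace Summit.Ventures.CertifiedManyBodySolver.Downfold

open NonemptyInterval Matrix Finset Literature.Probability.LatticeModels
open Literature.MathematicalPhysics.QuantumLattice Literature.Computation.Certificates
open Summit.Ventures.CertifiedManyBodySolver.Certificates OccupationCode ClusterLowerBound
open scoped BigOperators ComplexOrder

/-! ## §1 The atomic-limit floor on the box at εp = -99/10 -/

/-- **ATOMIC-LIMIT `T > 0` FLOOR** on the whole `emeryBoxHg1201LRFB`, cuprate signs, level εp = -99/10 (chemical potential 99/10 eV), EVERY β ≥ 0:
`log z₀(β; U_d = 4493/500, μ_d = 929/100) + 2·log z₀(β; U_p = 1351/250, μ_p = 99/10) ≤ P_cell` with `z₀(β; U, μ) = 1 + 2e^{βμ} + e^{−β(U−2μ)}` (`atomicPartitionFnReal`; Cu at the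
box's upper level `εp + Δ_hi = -929/100` and `U_d,hi`, O at `εp` and `U_p,hi`). Value `6 log 2` at β = 0; slope `38.3860·β` as β → ∞ (classical minimum, no hopping).
[cite: Ruelle1969, §2.5–2.6] [cite: Ueltschi1999, §3] -/
theorem emeryBoxHg1201LRFB_pressureAtomicFloor_m99o10 {β : ℝ} (hβ : 0 ≤ β) :
    HoldsOn (fun p : EmeryCoord → ℝ => Real.log (atomicPartitionFnReal β (4493/500 : ℝ) (929/100 : ℝ)) + 2 * Real.log (atomicPartitionFnReal β (1351/250 : ℝ) (99/10 : ℝ)) ≤ emeryCellPressure β (emeryLine cuprateSigns (emeryLineCoords (((-99/10 : ℚ)) : ℝ) p))) emeryBoxHg1201LRFB := by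
  intro p hp
  have h := holdsOn_emeryCellPressureAtomicFloor (E := emeryBoxHg1201LRFB) (eA := hg1201Emery_tpd) (eB := hg1201Emery_tpp) (eD := hg1201LRFBEmery_Delta) (eUd := hg1201LRFBEmery_Udd) (eUp := hg1201LRFBEmery_Upp) (-99/10) (by simp [emeryBoxHg1201LRFB, emeryBoxHg1201LRFBSrc, Function.update]) (by simp [emeryBoxHg1201LRFB, emeryBoxHg1201LRFBSrc, Function.update]) (Function.update_self _ _ _) (by simp [emeryBoxHg1201LRFB, emeryBoxHg1201LRFBSrc, Function.update]) (by simp [emeryBoxHg1201LRFB, emeryBoxHg1201LRFBSrc, Function.update]) cuprateSigns hβ p hp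
  simp only [hg1201LRFBEmery_Delta, hg1201LRFBEmery_Udd, hg1201LRFBEmery_Upp, Entry.encl_ofEnds_snd] at h
  push_cast at h
  norm_num at h ⊢
  exact h

/-! ## §2 The best floor and the HIGH-TEMPERATURE-CLOSING window -/

/-- **BEST `T > 0` FLOOR = max(atomic, family)** on the whole box at εp = -99/10, every β ≥ 0: the atomic floor (full entropy, slope 38.3860) wins for
β < β* ≈ 1.142 (T > 10158 K), the family floor `emeryBoxHg1201LRFB_pressureFloorFam_m99o10` (slope 39.0393, entropy ¼·log 2) for β > β*. [cite: Ruelle1969, §2.5–2.6] [cite: Israel1979, Lemma II.3.1] -/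
theorem emeryBoxHg1201LRFB_pressureFloorBest_m99o10 {β : ℝ} (hβ : 0 ≤ β) :
    HoldsOn (fun p : EmeryCoord → ℝ => max (Real.log (atomicPartitionFnReal β (4493/500 : ℝ) (929/100 : ℝ)) + 2 * Real.log (atomicPartitionFnReal β (1351/250 : ℝ) (99/10 : ℝ))) (Real.log (Real.exp (-(β * (-156157017/1000000 : ℝ))) + Real.exp (-(β * (-78023661/500000 : ℝ)))) / 4) ≤ emeryCellPressure β (emeryLine cuprateSigns (emeryLineCoords (((-99/10 : ℚ)) : ℝ) p))) emeryBoxHg1201LRFB :=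
  fun p hp => max_le (emeryBoxHg1201LRFB_pressureAtomicFloor_m99o10 hβ p hp) (emeryBoxHg1201LRFB_pressureFloorFam_m99o10 hβ p hp)

/-- **THE HIGH-TEMPERATURE-CLOSING TWO-SIDED `T > 0` WINDOW** (hypothesis-free on both sides) on the whole `emeryBoxHg1201LRFB`, level εp = -99/10, EVERY β ≥ 0:
`max(atomic, family) ≤ P_cell ≤ 6 log 2 + β·284783/6400` (cap = `emeryBoxHg1201LRFB_pressureCap_m99o10_retilt`, hubbard-box-p1 re-tilted). BOTH SIDES EQUAL `6 log 2` AT β = 0; the width is `O(β)` for small β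
(slope gap 6.1113 against the atomic floor, 5.4581 against the family floor). Table [float; `T = 11604.5/β` K]:
| β (1/eV) | T (K) | atomic floor | family floor | best floor | cap | width |
|---|---|---|---|---|---|---|
| 0.01 | 1160450 | 4.4039 | 0.5635 | 4.4039 | 4.6039 | 0.2000 |
| 0.1 | 116045 | 6.8823 | 4.0758 | 6.8823 | 8.6086 | 1.7263 |
| 0.5 | 23209 | 20.5804 | 19.6862 | 20.5804 | 26.4076 | 5.8271 |
| 1 | 11604 | 39.3367 | 39.1992 | 39.3367 | 48.6562 | 9.3195 |
| 2 | 5802 | 77.5091 | 78.2259 | 78.2259 | 93.1536 | 14.9277 |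
| 5 | 2321 | 192.2929 | 195.3103 | 195.3103 | 226.6456 | 31.3353 |
| 10 | 1160 | 383.9514 | 390.4646 | 390.4646 | 449.1323 | 58.6678 |
| 20 | 580 | 767.7246 | 780.8115 | 780.8115 | 894.1058 | 113.2942 |
| 40 | 290 | 1535.4400 | 1561.5733 | 1561.5733 | 1784.0526 | 222.4794 |
[cite: Israel1979, Thm. I.2.4] [cite: Ruelle1969, §2.5–2.6] [cite: Ueltschi1999, §3] -/
theorem emeryBoxHg1201LRFB_pressureWindowHighT_m99o10 {β : ℝ} (hβ : 0 ≤ β) :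
    HoldsOn (fun p : EmeryCoord → ℝ =>
      max (Real.log (atomicPartitionFnReal β (4493/500 : ℝ) (929/100 : ℝ)) + 2 * Real.log (atomicPartitionFnReal β (1351/250 : ℝ) (99/10 : ℝ))) (Real.log (Real.exp (-(β * (-156157017/1000000 : ℝ))) + Real.exp (-(β * (-78023661/500000 : ℝ)))) / 4) ≤ emeryCellPressure β (emeryLine cuprateSigns (emeryLineCoords (((-99/10 : ℚ)) : ℝ) p)) ∧
      emeryCellPressure β (emeryLine cuprateSigns (emeryLineCoords (((-99/10 : ℚ)) : ℝ) p)) ≤ 6 * Real.log 2 + β * (284783/6400 : ℝ)) emeryBoxHg1201LRFB :=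
  fun p hp => ⟨emeryBoxHg1201LRFB_pressureFloorBest_m99o10 hβ p hp, by simpa using emeryBoxHg1201LRFB_pressureCap_m99o10_retilt hβ p hp⟩

/-- **At β = 0 the window is a point**: `P_cell(0, ·) = 6 log 2` on the whole box (floor and cap coincide). [cite: Ueltschi1999, §3] -/
theorem emeryBoxHg1201LRFB_pressure_beta_zero_m99o10 :
    HoldsOn (fun p : EmeryCoord → ℝ => emeryCellPressure 0 (emeryLine cuprateSigns (emeryLineCoords (((-99/10 : ℚ)) : ℝ) p)) = 6 * Real.log 2) emeryBoxHg1201LRFB := by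
  intro p hp
  have h := emeryBoxHg1201LRFB_pressureWindowHighT_m99o10 le_rfl p hp
  rw [atomicPartitionFnReal_beta_zero, atomicPartitionFnReal_beta_zero, show (4 : ℝ) = 2 ^ 2 by norm_num, Real.log_pow] at h
  simp only [Nat.cast_ofNat, zero_mul, add_zero] at h
  have h1 := (le_max_left _ _).trans h.1
  linarith [h.2]

end Summit.Ventures.CertifiedManyBodySolver.Downfold

end
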